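import Summits.RiemannHypothesis.RiemannHypothesis.Theorems.WeilFormatCOddPolarBound
import Summits.RiemannHypothesis.RiemannHypothesis.Theorems.WeilFormatCSectorSplit
import Summits.RiemannHypothesis.RiemannHypothesis.Theorems.WeilFormatCEntryGram
import HarnessLib

/-!
# Format C: the POLAR block of Yoshida's Gram matrix — rank one per parity; `⪰ 0` on even vectors,
  `⪰ −(2s²a/(π²B))·1` on odd vectors supported on the far modes `|p| ≥ B + 1`

Route context: Fourier–Galerkin / Schur-complement certificates of Weil positivity on a window ("format C";
cell memo `run/shared/lean/pub/rh-explicit/rh-explicit-weil-10/FORMATC-DESIGN.md` §4.3 POLAR_off, §9.1; supporting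
stmt-RiemannHypothesis-0098; seat rh-explicit-weil-10).  Second analytic piece of L-C3a on the actual kernel
`Yoshida1992.polarCoeff` ((5.1): `(−1)^{n+m}(4/a)s²(1 − 4ω_nω_m)/((1+4ω_n²)(1+4ω_m²))`, `s = e^{a/2} − e^{−a/2}`,
`ω_n = πn/a`).  Writing `c_n = 1/(1+4ω_n²)` (even in `n`) and `d_n = ω_n/(1+4ω_n²)` (odd in `n`), the kernel is the
difference of two rank-one kernels, `(4s²/a)·(σ_nc_n)(σ_mc_m) − (16s²/a)·(σ_nd_n)(σ_md_m)`, `σ_n = (−1)^n`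
(`polarCoeff_eq_rankOne`), so its real quadratic form is `(4s²/a)(Σσ_nc_nx_n)² − (16s²/a)(Σσ_nd_nx_n)²`
(`polarCoeff_form_eq`).  On `modes N = {−N,…,N}`:

* `polarCoeff_form_nonneg_of_even` — for EVEN real `x` the `d`-sum cancels: `0 ≤ Σ x_px_q POL(p,q)`;
* `polarCoeff_form_ge_of_odd` — for ODD real `x` supported on `B+1 ≤ |p|` (`1 ≤ B`, `0 < a`) the `c`-sum cancels and
  Cauchy–Schwarz with `Σ_{n>B} d_n² ≤ a²/(16π²B)` (`WeilFormatC.sum_polarWeight_sq_le`, `WeilFormatCOddPolarBound.lean`)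
  gives `−(2s²a/(π²B))·Σ x_p² ≤ Σ x_px_q POL(p,q)`.

These are the `ℤ`-level inputs of `WeilFormatC.even_far_lower_const_of_modes` / `odd_far_lower_const_of_modes`
(`WeilFormatCSectorTransfer.lean`): hypothesis `hQ` of `WeilFormatC.farBlock_ge_dhat` for the sector kernels with `ϖ = 0`
(even) and `ϖ = s²a/(π²B)` (odd, M-units).  Elementary; standard axioms; no definitions; no RH claim.
-/

set_option autoImplicit false
-- `Summit.RiemannHypothesis.RiemannHypothesis.…` is the layout-mandated namespace (summit = problem name).
set_option linter.dupNamespace false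

noncomputable section

open Finset
open scoped Real BigOperators

namespace Summit.RiemannHypothesis.RiemannHypothesis.Theorems.WeilFormatC

open Literature.NumberTheory.LFunctions.Yoshida1992

/-! ## Signs `(−1)^n` for `n : ℤ` -/

/-- `(−1)^{n+m} = (−1)^n (−1)^m` in `ℝ`. -/
theorem neg_one_zpow_add (n m : ℤ) : (-1 : ℝ) ^ (n + m) = (-1) ^ n * (-1) ^ m :=
  zpow_add₀ (by norm_num) n m

/-- `((−1)^n)² = 1` in `ℝ`. -/
theorem neg_one_zpow_sq (n : ℤ) : ((-1 : ℝ) ^ n) ^ 2 = 1 := by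
  rcases Int.even_or_odd n with h | h
  · rw [h.neg_one_zpow]; norm_num
  · rw [h.neg_one_zpow]; norm_num

/-- `(−1)^{−n} = (−1)^n` in `ℝ`. -/
theorem neg_one_zpow_neg' (n : ℤ) : (-1 : ℝ) ^ (-n) = (-1) ^ n := by
  rcases Int.even_or_odd n with h | h
  · rw [h.neg_one_zpow, h.neg.neg_one_zpow]
  · rw [h.neg_one_zpow, h.neg.neg_one_zpow]

/-! ## Sums of odd functions over `modes N` vanish -/

/-- If `f(−p) = −f(p)` then `Σ_{p ∈ modes N} f(p) = 0`. -/
theorem sum_modes_eq_zero_of_odd (f : ℤ → ℝ) (hf : ∀ p, f (-p) = -f p) (N : ℕ) :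
    ∑ p ∈ modes N, f p = 0 := by
  have h0 : f 0 = 0 := by
    have h := hf 0
    rw [neg_zero] at h
    linarith
  rw [sum_modes_eq, h0, zero_add]
  refine Finset.sum_eq_zero fun k _ ↦ ?_
  rw [hf]; ring

/-! ## The polar kernel is a difference of two rank-one kernels -/

section Polar

variable {a : ℝ}

/-- `POL(n,m) = (4s²/a)·(σ_nc_n)(σ_mc_m) − (16s²/a)·(σ_nd_n)(σ_md_m)` with `σ_n = (−1)^n`, `c_n = 1/(1+4ω_n²)`,
`d_n = ω_n/(1+4ω_n²)`, `s² = (e^{a/2} − e^{−a/2})²`. -/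
theorem polarCoeff_eq_rankOne (a : ℝ) (n m : ℤ) :
    polarCoeff a n m
      = 4 / a * (Real.exp (a / 2) - Real.exp (-(a / 2))) ^ 2 *
          (((-1 : ℝ) ^ n * (1 / (1 + 4 * freq a n ^ 2))) * ((-1 : ℝ) ^ m * (1 / (1 + 4 * freq a m ^ 2))))
        - 16 / a * (Real.exp (a / 2) - Real.exp (-(a / 2))) ^ 2 *
          (((-1 : ℝ) ^ n * (freq a n / (1 + 4 * freq a n ^ 2))) *
            ((-1 : ℝ) ^ m * (freq a m / (1 + 4 * freq a m ^ 2)))) := by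
  unfold polarCoeff
  rw [neg_one_zpow_add]
  have h1 : (1 + 4 * freq a n ^ 2) ≠ 0 := by positivity
  have h2 : (1 + 4 * freq a m ^ 2) ≠ 0 := by positivity
  field_simp
  ring

/-- **The polar quadratic form**: `Σ_{p,q∈s} x_p x_q POL(p,q) = (4s²/a)(Σ_p σ_pc_px_p)² − (16s²/a)(Σ_p σ_pd_px_p)²`. -/
theorem polarCoeff_form_eq (a : ℝ) (s : Finset ℤ) (x : ℤ → ℝ) :
    ∑ p ∈ s, ∑ q ∈ s, x p * x q * polarCoeff a p q
      = 4 / a * (Real.exp (a / 2) - Real.exp (-(a / 2))) ^ 2 *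
          (∑ p ∈ s, (-1 : ℝ) ^ p * (1 / (1 + 4 * freq a p ^ 2)) * x p) ^ 2
        - 16 / a * (Real.exp (a / 2) - Real.exp (-(a / 2))) ^ 2 *
          (∑ p ∈ s, (-1 : ℝ) ^ p * (freq a p / (1 + 4 * freq a p ^ 2)) * x p) ^ 2 := by
  have hsq : ∀ f : ℤ → ℝ, (∑ p ∈ s, f p) ^ 2 = ∑ p ∈ s, ∑ q ∈ s, f p * f q := fun f ↦ by
    rw [sq, Finset.sum_mul_sum]
  rw [hsq, hsq, Finset.mul_sum, Finset.mul_sum, ← Finset.sum_sub_distrib]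
  refine Finset.sum_congr rfl fun p _ ↦ ?_
  rw [Finset.mul_sum, Finset.mul_sum, ← Finset.sum_sub_distrib]
  refine Finset.sum_congr rfl fun q _ ↦ ?_
  rw [polarCoeff_eq_rankOne]
  ring

/-- **Even vectors: the polar form is nonnegative.**  For EVEN real `x` on `modes N` the odd direction `σ_pd_px_p` sums
to zero and `Σ x_px_q POL(p,q) = (4s²/a)(Σσ_pc_px_p)² ≥ 0` (`0 < a`). -/
theorem polarCoeff_form_nonneg_of_even (ha : 0 < a) (N : ℕ) (x : ℤ → ℝ) (hx : ∀ p, x (-p) = x p) :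
    0 ≤ ∑ p ∈ modes N, ∑ q ∈ modes N, x p * x q * polarCoeff a p q := by
  rw [polarCoeff_form_eq]
  have hd : ∑ p ∈ modes N, (-1 : ℝ) ^ p * (freq a p / (1 + 4 * freq a p ^ 2)) * x p = 0 := by
    refine sum_modes_eq_zero_of_odd _ (fun p ↦ ?_) N
    rw [neg_one_zpow_neg', freq_neg, hx]
    ring
  rw [hd]
  have : 0 ≤ 4 / a * (Real.exp (a / 2) - Real.exp (-(a / 2))) ^ 2 *
      (∑ p ∈ modes N, (-1 : ℝ) ^ p * (1 / (1 + 4 * freq a p ^ 2)) * x p) ^ 2 := by positivity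
  simpa using this

/-- `Σ_{p ∈ modes N, B+1 ≤ |p|} d_p² = 2·Σ_{n ∈ Ioc B N} d_n²` — the far polar weights on both signs. -/
theorem sum_modes_far_polarWeight_sq (a : ℝ) (B N : ℕ) :
    ∑ p ∈ modes N, (if B + 1 ≤ p.natAbs then (freq a p / (1 + 4 * freq a p ^ 2)) ^ 2 else 0)
      = 2 * ∑ n ∈ Finset.Ioc B N, (π * n / a / (1 + 4 * (π * n / a) ^ 2)) ^ 2 := by
  rw [sum_modes_eq]
  simp only [Int.natAbs_zero]
  rw [if_neg (by omega), zero_add]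
  have hk : ∀ k : ℕ, ((k : ℤ) + 1).natAbs = k + 1 := fun k ↦ by
    rw [show ((k : ℤ) + 1) = ((k + 1 : ℕ) : ℤ) by push_cast; ring, Int.natAbs_natCast]
  have hterm : ∀ k : ℕ,
      (if B + 1 ≤ ((k : ℤ) + 1).natAbs then (freq a ((k : ℤ) + 1) / (1 + 4 * freq a ((k : ℤ) + 1) ^ 2)) ^ 2 else 0)
        + (if B + 1 ≤ (-((k : ℤ) + 1)).natAbs then
            (freq a (-((k : ℤ) + 1)) / (1 + 4 * freq a (-((k : ℤ) + 1)) ^ 2)) ^ 2 else 0)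
        = 2 * (if B + 1 ≤ k + 1 then (π * ((k + 1 : ℕ) : ℝ) / a / (1 + 4 * (π * ((k + 1 : ℕ) : ℝ) / a) ^ 2)) ^ 2
            else 0) := by
    intro k
    rw [Int.natAbs_neg, hk, freq_neg]
    have e : freq a ((k : ℤ) + 1) = π * ((k + 1 : ℕ) : ℝ) / a := by
      unfold freq; push_cast; ring
    rw [e]
    split_ifs <;> ring
  rw [Finset.sum_congr rfl fun k _ ↦ hterm k, ← Finset.mul_sum]
  congr 1
  rw [Finset.range_eq_Ico, Finset.sum_Ico_add' (fun n : ℕ ↦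
    if B + 1 ≤ n then (π * (n : ℝ) / a / (1 + 4 * (π * (n : ℝ) / a) ^ 2)) ^ 2 else 0) 0 N 1, zero_add]
  have hI : Finset.Ioc B N = (Finset.Ico 1 (N + 1)).filter (fun n ↦ B + 1 ≤ n) := by
    ext n
    simp only [Finset.mem_Ioc, Finset.mem_filter, Finset.mem_Ico]
    omega
  rw [hI, Finset.sum_filter]

/-- **Odd vectors on the far modes: the polar form is `≥ −(2s²a/(π²B))·‖x‖²`.**  For ODD real `x` on `modes N`
supported on `B + 1 ≤ |p|` (`1 ≤ B`, `0 < a`) the even direction `σ_pc_px_p` sums to zero, and by Cauchy–Schwarz with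
`Σ_{B<|p|≤N} d_p² ≤ a²/(8π²B)`:  `−(2s²a/(π²B))·Σ_p x_p² ≤ Σ_{p,q} x_px_q POL(p,q)`. -/
theorem polarCoeff_form_ge_of_odd (ha : 0 < a) {B : ℕ} (hB : 1 ≤ B) (N : ℕ) (x : ℤ → ℝ)
    (hx : ∀ p, x (-p) = -x p) (hsupp : ∀ p : ℤ, p.natAbs < B + 1 → x p = 0) :
    -(2 * (Real.exp (a / 2) - Real.exp (-(a / 2))) ^ 2 * a / (π ^ 2 * B)) * ∑ p ∈ modes N, x p ^ 2
      ≤ ∑ p ∈ modes N, ∑ q ∈ modes N, x p * x q * polarCoeff a p q := by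
  rw [polarCoeff_form_eq]
  -- the even direction cancels
  have hc : ∑ p ∈ modes N, (-1 : ℝ) ^ p * (1 / (1 + 4 * freq a p ^ 2)) * x p = 0 := by
    refine sum_modes_eq_zero_of_odd _ (fun p ↦ ?_) N
    rw [neg_one_zpow_neg', freq_neg, hx]
    ring
  rw [hc]
  simp only [ne_eq, OfNat.ofNat_ne_zero, not_false_eq_true, zero_pow, mul_zero, zero_sub]
  -- Cauchy–Schwarz on the odd direction, with the support restriction folded into the weight
  set w : ℤ → ℝ := fun p ↦ if B + 1 ≤ p.natAbs then (-1 : ℝ) ^ p * (freq a p / (1 + 4 * freq a p ^ 2)) else 0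
    with hw
  have hsum : ∑ p ∈ modes N, (-1 : ℝ) ^ p * (freq a p / (1 + 4 * freq a p ^ 2)) * x p
      = ∑ p ∈ modes N, w p * x p := by
    refine Finset.sum_congr rfl fun p _ ↦ ?_
    by_cases hp : B + 1 ≤ p.natAbs
    · simp only [hw, if_pos hp]
    · rw [hsupp p (by omega), mul_zero, mul_zero]
  have hcs := Finset.sum_mul_sq_le_sq_mul_sq (modes N) w x
  have hw2 : ∑ p ∈ modes N, w p ^ 2
      = ∑ p ∈ modes N, (if B + 1 ≤ p.natAbs then (freq a p / (1 + 4 * freq a p ^ 2)) ^ 2 else 0) := by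
    refine Finset.sum_congr rfl fun p _ ↦ ?_
    simp only [hw]
    split_ifs
    · rw [mul_pow, neg_one_zpow_sq, one_mul]
    · simp
  have hfar : ∑ p ∈ modes N, w p ^ 2 ≤ a ^ 2 / (8 * π ^ 2 * B) := by
    rw [hw2, sum_modes_far_polarWeight_sq]
    have h := sum_polarWeight_sq_le (N := N) ha hB
    have e : a ^ 2 / (8 * π ^ 2 * B) = 2 * (a ^ 2 / (16 * π ^ 2 * B)) := by ring
    rw [e]
    linarith
  rw [hsum]
  have hx2 : 0 ≤ ∑ p ∈ modes N, x p ^ 2 := Finset.sum_nonneg fun p _ ↦ sq_nonneg _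
  have h1 : (∑ p ∈ modes N, w p * x p) ^ 2 ≤ a ^ 2 / (8 * π ^ 2 * B) * ∑ p ∈ modes N, x p ^ 2 :=
    hcs.trans (mul_le_mul_of_nonneg_right hfar hx2)
  have hK : 0 ≤ 16 / a * (Real.exp (a / 2) - Real.exp (-(a / 2))) ^ 2 := by positivity
  have h2 := mul_le_mul_of_nonneg_left h1 hK
  have e : 16 / a * (Real.exp (a / 2) - Real.exp (-(a / 2))) ^ 2 * (a ^ 2 / (8 * π ^ 2 * B) * ∑ p ∈ modes N, x p ^ 2)
      = 2 * (Real.exp (a / 2) - Real.exp (-(a / 2))) ^ 2 * a / (π ^ 2 * B) * ∑ p ∈ modes N, x p ^ 2 := by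
    field_simp
    ring
  rw [e] at h2
  linarith

end Polar

end Summit.RiemannHypothesis.RiemannHypothesis.Theorems.WeilFormatC

end
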